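import Mathlib

/-!
# Kink contacts of the low branch, I: the downstream landing — junction algebra, the corner-landing
# parabola, the two-mode tail and the cliff-corner selection (solo-blind, s46)

Kernel of solo-blind paper §24.28 (3) (CLAIMS SB-C452–C453, predictions SB-C457).  Companion file:
`SoloBlindKinkLiftoff` (upstream junction, kink selection, Painlevé-II scalings of both corners).

In the layer variable `ξ = (x - x_R)/ℓ` the leading-order inner problem at the downstream contact of
the low branch is explicit.  On the dead side the mean-flow modes are the two decaying solutions
`e^{-ξ/2} cos ωξ`, `e^{-ξ/2} sin ωξ` of `m‴ = m`, `ω = √3/2` (`tailMode`, `tailMode_deriv3`).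
`C²`-matching of `u - A Q̂` across the contact gives three linear junction rules for the four inner
unknowns `(ĉ, ŝ, β̂, γ̂)` — a one-parameter family (`landing_family`); the corner dynamics select
`γ̂ = 0` (`cliff_corner_crossing`: on the saddle's energy level a cliff `γ̂ > 0` reaches `a = 0` with
`a'² = Kγ̂²/2 ≠ 0`, so it cannot stop there), whence `ŝ = ĉ/(2ω)`, `β̂ = ĉ/A` (`landing_junction`),
the landing parabola `Q̂ = C₂ ξ (ξ - 2)` (`landingQ`; virtual vertex exactly one `ℓ` downstream with
value `-C₂`, parameter-free ratios `3/8`, `5/32` against the tangential `1/4`, `1/16`), and the tail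
`M̂ = (J/ω) e^{-ξ/2} sin ωξ = d/dξ (u - u_∞)` (`hasDerivAt_tailU`): shear continuous at the contact,
lobe ratio `-e^{-π/(2ω)} = -e^{-π/√3}` whatever the phase, first zero at `π/ω`, first extremum at
`ξ₁ = π/(3ω)` with `(μ_max - μ_R)ℓ/J = e^{-π/(3√3)}` (`tail_lobe_ratio`, `tail_first_zero`,
`tail_first_extremum`, `tail_peak_value`).

Everything here is exact algebra / one-variable calculus over `ℝ`; no asymptotics is formalised.
-/

namespace Summit.AnomalousDissipation.AnomalousDissipation.Theorems

open Real

/-! ## The downstream frequency `ω = √3/2` -/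

/-- The downstream F2 frequency `ω = √3/2`. -/
noncomputable def omegaD : ℝ := Real.sqrt 3 / 2

/-- `ω² = 3/4`. -/
theorem omegaD_sq : omegaD ^ 2 = 3 / 4 := by
  unfold omegaD
  rw [div_pow, Real.sq_sqrt (by norm_num : (0:ℝ) ≤ 3)]
  norm_num

/-- `ω > 0`. -/
theorem omegaD_pos : 0 < omegaD := by
  unfold omegaD
  have : 0 < Real.sqrt 3 := Real.sqrt_pos.mpr (by norm_num)
  linarith

/-- `ω² + 1/4 = 1`: the characteristic roots `-1/2 ± iω` of `r³ = 1` lie on the unit circle. -/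
theorem omegaD_sq_add_quarter : omegaD ^ 2 + 1 / 4 = 1 := by
  rw [omegaD_sq]; norm_num

/-- `2ω = √3`, so `π/(2ω) = π/√3` (the lobe-ratio exponent) and `π/(3ω)·(1/2) = π/(3√3)`. -/
theorem two_omegaD : 2 * omegaD = Real.sqrt 3 := by
  unfold omegaD; ring

/-! ## Two-mode downstream tails -/

/-- A downstream two-mode tail `ξ ↦ e^{-ξ/2} (c cos ωξ + s sin ωξ)`. -/
noncomputable def tailMode (ω c s ξ : ℝ) : ℝ :=
  Real.exp (-ξ / 2) * (c * Real.cos (ω * ξ) + s * Real.sin (ω * ξ))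

/-- Differentiating a tail mode maps the coefficient pair `(c, s)` to `(-c/2 + ω s, -s/2 - ω c)`. -/
theorem hasDerivAt_tailMode (ω c s ξ : ℝ) :
    HasDerivAt (tailMode ω c s) (tailMode ω (-c / 2 + ω * s) (-s / 2 - ω * c) ξ) ξ := by
  have h1 : HasDerivAt (fun x : ℝ => Real.exp (-x / 2)) (Real.exp (-ξ / 2) * (-1 / 2)) ξ :=
    ((hasDerivAt_id' ξ).neg.div_const 2).exp
  have h2 : HasDerivAt (fun x : ℝ => Real.cos (ω * x)) (-Real.sin (ω * ξ) * (ω * 1)) ξ :=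
    ((hasDerivAt_id' ξ).const_mul ω).cos
  have h3 : HasDerivAt (fun x : ℝ => Real.sin (ω * x)) (Real.cos (ω * ξ) * (ω * 1)) ξ :=
    ((hasDerivAt_id' ξ).const_mul ω).sin
  have h4 : HasDerivAt (fun x : ℝ => Real.exp (-x / 2) * (c * Real.cos (ω * x) + s * Real.sin (ω * x)))
      (Real.exp (-ξ / 2) * (-1 / 2) * (c * Real.cos (ω * ξ) + s * Real.sin (ω * ξ))
        + Real.exp (-ξ / 2) * (c * (-Real.sin (ω * ξ) * (ω * 1)) + s * (Real.cos (ω * ξ) * (ω * 1)))) ξ :=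
    h1.mul ((h2.const_mul c).add (h3.const_mul s))
  refine h4.congr_deriv ?_
  unfold tailMode
  ring

/-- `deriv` form of `hasDerivAt_tailMode`. -/
theorem deriv_tailMode (ω c s : ℝ) :
    deriv (tailMode ω c s) = tailMode ω (-c / 2 + ω * s) (-s / 2 - ω * c) := by
  funext ξ
  exact (hasDerivAt_tailMode ω c s ξ).deriv

/-- The dead-side F2 equation downstream: the third derivative of a tail mode is the mode itself,
exactly when `ω² = 3/4` (the coefficient map `(c,s) ↦ (-c/2 + ωs, -s/2 - ωc)` has cube `1`). -/
theorem tailMode_deriv3 (ω c s : ℝ) (hω : ω ^ 2 = 3 / 4) :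
    deriv (deriv (deriv (tailMode ω c s))) = tailMode ω c s := by
  simp only [deriv_tailMode]
  refine congrArg₂ (tailMode ω) ?_ ?_
  · linear_combination (3 / 2 * c - ω * s) * hω
  · linear_combination (3 / 2 * s + ω * c) * hω

/-! ## The downstream junction: a one-parameter family, and its selected member -/

/-- The three `C²`-junction rules `ĉ = -J`, `-ĉ/2 + ŝω = -Aγ̂`, `-ĉ/2 - ŝω = -Aβ̂` for the four inner
unknowns leave a ONE-PARAMETER family, parametrised by the corner value `γ̂ = Q̂(0⁻)`. -/
theorem landing_family (ω A J c s β γ : ℝ) (hω : ω ≠ 0) (hA : A ≠ 0)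
    (h1 : c = -J) (h2 : -c / 2 + s * ω = -A * γ) (h3 : -c / 2 - s * ω = -A * β) :
    s = (-J / 2 - A * γ) / ω ∧ β = -J / A - γ := by
  subst h1
  constructor
  · rw [eq_div_iff hω]; linarith
  · have h4 : A * β = -J - A * γ := by linarith
    field_simp
    linarith

/-- The selected member `γ̂ = 0`: `ŝ = ĉ/(2ω) = -J/(2ω)` and `β̂ = ĉ/A = -J/A`; with `J = 2AC₂`
(`[u] = A q''(x_R⁻)`), `β̂ = -2C₂`. -/
theorem landing_junction (ω A J C2 c s β γ : ℝ) (hω : ω ≠ 0) (hA : A ≠ 0)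
    (h1 : c = -J) (h2 : -c / 2 + s * ω = -A * γ) (h3 : -c / 2 - s * ω = -A * β) (h4 : γ = 0)
    (hJ : J = 2 * A * C2) :
    s = -J / (2 * ω) ∧ β = -J / A ∧ β = -2 * C2 := by
  obtain ⟨hs, hb⟩ := landing_family ω A J c s β γ hω hA h1 h2 h3
  subst h4
  refine ⟨?_, ?_, ?_⟩
  · rw [hs]; field_simp; ring
  · rw [hb]; ring
  · rw [hb, hJ]; field_simp; ring

/-- The corner-landing parabola `Q̂(ξ) = C₂ ξ (ξ - 2)` (`= C₂ξ² + β̂ξ + γ̂` with `β̂ = -2C₂`, `γ̂ = 0`). -/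
noncomputable def landingQ (C2 ξ : ℝ) : ℝ := C2 * ξ * (ξ - 2)

/-- `Q̂ = C₂ξ² - 2C₂ξ`. -/
theorem landingQ_eq (C2 ξ : ℝ) : landingQ C2 ξ = C2 * ξ ^ 2 + (-2 * C2) * ξ + 0 := by
  unfold landingQ; ring

/-- Vertex form: the virtual vertex sits exactly ONE layer width downstream of the contact, with
value `-C₂` (`q_v = -C₂ℓ²`). -/
theorem landingQ_vertex (C2 ξ : ℝ) : landingQ C2 ξ = C2 * (ξ - 1) ^ 2 - C2 := by
  unfold landingQ; ring

/-- Corner slope `Q̂'(0) = -2C₂` (`q'(x_R⁻) = -2C₂ℓ = -[u]ℓ/A` at the layer scale). -/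
theorem hasDerivAt_landingQ (C2 ξ : ℝ) : HasDerivAt (landingQ C2) (2 * C2 * ξ - 2 * C2) ξ := by
  have h : HasDerivAt (fun x : ℝ => C2 * x ^ 2 + (-2 * C2) * x) (C2 * (↑(2:ℕ) * ξ ^ (2 - 1)) + (-2 * C2) * 1) ξ :=
    ((hasDerivAt_pow 2 ξ).const_mul C2).add ((hasDerivAt_id' ξ).const_mul (-2 * C2))
  have hf : landingQ C2 = fun x : ℝ => C2 * x ^ 2 + (-2 * C2) * x := by
    funext x; unfold landingQ; ring
  rw [hf]
  refine h.congr_deriv ?_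
  push_cast; ring

/-- The parameter-free KINK-landing ratios registered before the data (SB-C457):
`q(x_R - ℓ)/q(x_R - 2ℓ) = 3/8`, `q(x_R - ℓ/2)/q(x_R - 2ℓ) = 5/32`, `q_v/(C₂ℓ²) = -1`. -/
theorem landingQ_ratios (C2 : ℝ) (hC : C2 ≠ 0) :
    landingQ C2 (-1) / landingQ C2 (-2) = 3 / 8 ∧
    landingQ C2 (-1/2) / landingQ C2 (-2) = 5 / 32 ∧
    landingQ C2 1 / C2 = -1 := by
  unfold landingQ
  refine ⟨?_, ?_, ?_⟩
  · rw [div_eq_iff (by positivity)]; ring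
  · rw [div_eq_iff (by positivity)]; ring
  · rw [div_eq_iff hC]; ring

/-- For comparison: a TANGENTIAL inner landing `q ∝ ξ²` would give the ratios `1/4` and `1/16`. -/
theorem tangential_ratios : ((-1:ℝ) ^ 2 / (-2) ^ 2 = 1 / 4) ∧ ((-1/2:ℝ) ^ 2 / (-2) ^ 2 = 1 / 16) := by
  constructor <;> norm_num

/-! ## The selected downstream tail -/

/-- With `ω² = 3/4`, the selected velocity tail `u - u_∞ = -J e^{-ξ/2}(cos ωξ + sin ωξ/(2ω))` has
derivative `M̂ = (J/ω) e^{-ξ/2} sin ωξ`: the shear is CONTINUOUS at the contact (`M̂(0) = 0`) and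
departs linearly. -/
theorem hasDerivAt_tailU (J ω ξ : ℝ) (hω : ω ^ 2 = 3 / 4) :
    HasDerivAt (tailMode ω (-J) (-J / (2 * ω))) (tailMode ω 0 (J / ω) ξ) ξ := by
  have hne : ω ≠ 0 := by
    intro h; rw [h] at hω; norm_num at hω
  have h := hasDerivAt_tailMode ω (-J) (-J / (2 * ω)) ξ
  refine h.congr_deriv ?_
  refine congrArg₂ (fun a b => tailMode ω a b ξ) ?_ ?_
  · field_simp; ring
  · rw [eq_div_iff hne]
    field_simp
    linear_combination (4 * J) * hω

/-- The shear tail vanishes at the contact. -/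
theorem tail_at_contact (J ω : ℝ) : tailMode ω 0 (J / ω) 0 = 0 := by
  unfold tailMode; simp

/-- First zero of `μ - μ_R` beyond the contact at `ξ = π/ω` (`= 2π/√3 ≈ 3.628`). -/
theorem tail_first_zero (J ω : ℝ) (hω : ω ≠ 0) : tailMode ω 0 (J / ω) (Real.pi / ω) = 0 := by
  unfold tailMode
  rw [mul_div_cancel₀ _ hω, Real.sin_pi]
  ring

/-- Lobe law of a pure two-mode tail: half a period later the tail is multiplied by `-e^{-π/(2ω)}`
(`= -e^{-π/√3} ≈ -0.1630` for `ω = √3/2`), WHATEVER the phase. -/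
theorem tail_lobe_ratio (ω c s ξ : ℝ) (hω : ω ≠ 0) :
    tailMode ω c s (ξ + Real.pi / ω) = -Real.exp (-(Real.pi / (2 * ω))) * tailMode ω c s ξ := by
  unfold tailMode
  have h1 : ω * (ξ + Real.pi / ω) = ω * ξ + Real.pi := by
    field_simp
  rw [h1, Real.sin_add_pi, Real.cos_add_pi]
  have h2 : Real.exp (-(ξ + Real.pi / ω) / 2) = Real.exp (-(Real.pi / (2 * ω))) * Real.exp (-ξ / 2) := by
    rw [← Real.exp_add]
    congr 1
    field_simp
    ring
  rw [h2]
  ring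

/-- The lobe-ratio exponent for `ω = √3/2` is `π/√3`. -/
theorem lobe_exponent : Real.pi / (2 * omegaD) = Real.pi / Real.sqrt 3 := by
  rw [two_omegaD]

/-- The extrema of the shear tail `e^{-ξ/2} sin ωξ` (derivative coefficients `(ω, -1/2)`):
the first one sits at `ωξ = π/3`, i.e. `ξ = π/(3ω) = 2π/(3√3) ≈ 1.209`. -/
theorem tail_first_extremum :
    tailMode omegaD omegaD (-1/2) (Real.pi / 3 / omegaD) = 0 := by
  unfold tailMode
  have hne : omegaD ≠ 0 := ne_of_gt omegaD_pos
  have h1 : omegaD * (Real.pi / 3 / omegaD) = Real.pi / 3 := by field_simp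
  rw [h1, Real.cos_pi_div_three, Real.sin_pi_div_three]
  unfold omegaD
  ring

/-- `d/dξ (e^{-ξ/2} sin ωξ) = e^{-ξ/2}(ω cos ωξ - ½ sin ωξ)`, the mode used in `tail_first_extremum`. -/
theorem hasDerivAt_shear_tail (ω ξ : ℝ) :
    HasDerivAt (tailMode ω 0 1) (tailMode ω ω (-1/2) ξ) ξ := by
  have h := hasDerivAt_tailMode ω 0 1 ξ
  refine h.congr_deriv ?_
  refine congrArg₂ (fun a b => tailMode ω a b ξ) ?_ ?_ <;> ring

/-- Peak value: `(μ_max - μ_R) ℓ / J = (1/ω) e^{-ξ₁/2} sin(π/3) = e^{-π/(3√3)} ≈ 0.5463` at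
`ξ₁ = π/(3ω)`. -/
theorem tail_peak_value :
    tailMode omegaD 0 (1 / omegaD) (Real.pi / 3 / omegaD) = Real.exp (-(Real.pi / (3 * Real.sqrt 3))) := by
  unfold tailMode
  have hne : omegaD ≠ 0 := ne_of_gt omegaD_pos
  have h3 : Real.sqrt 3 ≠ 0 := by positivity
  have h1 : omegaD * (Real.pi / 3 / omegaD) = Real.pi / 3 := by field_simp
  have h2 : -(Real.pi / 3 / omegaD) / 2 = -(Real.pi / (3 * Real.sqrt 3)) := by
    unfold omegaD; field_simp
  rw [h1, Real.cos_pi_div_three, Real.sin_pi_div_three, h2]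
  have h4 : (0 : ℝ) * (1 / 2) + 1 / omegaD * (Real.sqrt 3 / 2) = 1 := by
    have : Real.sqrt 3 / 2 = omegaD := rfl
    rw [this, zero_mul, zero_add, one_div, inv_mul_cancel₀ hne]
  rw [h4, mul_one]

/-! ## Why `γ̂ = 0`: a cliff corner cannot stop -/

/-- Potential of the cliff-corner equation `α'' = -K(γ - α²)α = -V'(α)`. -/
noncomputable def cornerV (K γ α : ℝ) : ℝ := K * (γ * α ^ 2 / 2 - α ^ 4 / 4)

/-- Energy conservation along solutions of the cliff-corner equation. -/
theorem corner_energy_conserved (K γ : ℝ) (a a1 : ℝ → ℝ) (a2 ξ : ℝ)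
    (ha : HasDerivAt a (a1 ξ) ξ) (ha1 : HasDerivAt a1 a2 ξ)
    (hode : a2 = -K * (γ - a ξ ^ 2) * a ξ) :
    HasDerivAt (fun x => a1 x ^ 2 / 2 + cornerV K γ (a x)) 0 ξ := by
  have h1 : HasDerivAt (fun x => a1 x ^ 2 / 2) (↑(2:ℕ) * a1 ξ ^ (2 - 1) * a2 / 2) ξ :=
    (ha1.pow 2).div_const 2
  have h2 : HasDerivAt (fun x => cornerV K γ (a x))
      (K * (γ * (↑(2:ℕ) * a ξ ^ (2 - 1) * a1 ξ) / 2 - ↑(4:ℕ) * a ξ ^ (4 - 1) * a1 ξ / 4)) ξ := by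
    unfold cornerV
    exact ((((ha.pow 2).const_mul γ).div_const 2).sub ((ha.pow 4).div_const 4)).const_mul K
  refine (h1.add h2).congr_deriv ?_
  push_cast
  rw [hode]
  ring

/-- The saddle `α = √γ` has energy `Kγ²/4`; the centre `α = 0` has energy `0`. -/
theorem cornerV_levels (K γ : ℝ) (hγ : 0 ≤ γ) :
    cornerV K γ (Real.sqrt γ) = K * γ ^ 2 / 4 ∧ cornerV K γ 0 = 0 := by
  unfold cornerV
  have h2 : Real.sqrt γ ^ 2 = γ := Real.sq_sqrt hγ
  have h4 : Real.sqrt γ ^ 4 = γ ^ 2 := by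
    calc Real.sqrt γ ^ 4 = (Real.sqrt γ ^ 2) ^ 2 := by ring
      _ = γ ^ 2 := by rw [h2]
  rw [h2, h4]
  constructor <;> ring

/-- CLIFF CORNERS DO NOT STOP: an orbit on the saddle's energy level (`α → √γ̂` on the live side)
reaches `α = 0` with `α'² = Kγ̂²/2 > 0`, so `q = α²` touches zero and rises again — not a contact.
Hence the admissible landing has `γ̂ = 0`. -/
theorem cliff_corner_crossing (K γ α1 : ℝ) (hK : 0 < K) (hγ : 0 < γ)
    (henergy : α1 ^ 2 / 2 + cornerV K γ 0 = cornerV K γ (Real.sqrt γ)) :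
    α1 ^ 2 = K * γ ^ 2 / 2 ∧ 0 < α1 ^ 2 := by
  obtain ⟨hs, h0⟩ := cornerV_levels K γ hγ.le
  rw [hs, h0] at henergy
  have h : α1 ^ 2 = K * γ ^ 2 / 2 := by linarith
  refine ⟨h, ?_⟩
  rw [h]; positivity

end Summit.AnomalousDissipation.AnomalousDissipation.Theorems
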